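import Summits.BirchSwinnertonDyer.BirchSwinnertonDyer.Theorems.ManinLocalTwoThreeTranslationStableTwistInvariance
import HarnessLib

/-!
# Plane-index transport for the Conway–Norton lattice at `3` — the operator algebra behind E-desc-52

Summit `BirchSwinnertonDyer`, sub-problem `BirchSwinnertonDyer`, route `ManinLocalTwoThree` (Manin constant at the
additive primes `2, 3`); width seat `bsd-line-manin23-p2` (gen 9), `--supports` the crux C3 `ManinPrimeToThreeAtNine`
(stmt-BirchSwinnertonDyer-22968).  Cell `bsd-f2-manin`, descent lens (desc g8 MEMO-desc §25.3, typed leaf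
`…ManinAdditive.ConwayNortonThree`, theorem target E-desc-52 `EisensteinDepthTwistLipschitz`; refuter-1 §R64 R-2 land
order «51′ → 54 → 52»; desc g10 MEMO-desc §27.1 answer to this seat's gap note).  This file is the E-blind transport
step of E-desc-52; the membership step (P-desc-2) and the by-name theorem follow in a sibling file.

PROVED here (sorry-free):

* `relIndex_dvd_relIndex_mul_of_mul_le` — for additive subgroups `Λ ≤ A, B` of `ℂ` with `π A ⊆ B`, `π Λ ⊆ Λ`
  (`π ≠ 0`): `[A : Λ] ∣ [Λ : πΛ] · [B : Λ]` (two index chains below `B` ending at `πΛ`);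
* `div_pow_eq_and_natAbs_sub_le_one_of_dvd_three_mul` — `a ∣ 3b ∧ b ∣ 3a ⇒` equal prime-to-`3` parts and
  `|v₃ a − v₃ b| ≤ 1`;
* `planeIndex_eq_relIndex` — **`planeIndex M h = [⟨h, M⟩ : ⟨h, M ∩ (ℤh + ℤζ₃h)⟩]`** inside `ℂ` (first isomorphism
  theorem for the Petersson functional `⟨h, ·⟩` restricted to `M`);
* `thirdTranslate_two_eq_comp` (`t_{2/3} = t_{1/3}²`, `9 ∣ N`), `smul_twistOperatorAtThree_eq_sub`
  (`(ζ₃ − ζ₃²) B₃ = t_{1/3} − t_{2/3} =: D`), closure properties of `M^G(N) = conwayNortonLatticeAtThree N`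
  (`≤ S ⊗ ℤ[ζ₃]`, `ζ₃`-, `w_Q`-, `t_{1/3}`-, hence **`D`-stable**: `smul_twistOperatorAtThree_mem_conwayNortonLatticeAtThree`),
  and `le_conwayNortonLatticeAtThree` (maximality);
* `peterssonProduct_smul_twistOperatorAtThree_of_swap` — `⟨g, D x⟩ = (ζ₃ − ζ₃²)⟨f, x⟩` for `B₃ g = f` (self-adjointness
  of `B₃`, this seat's g8 `peterssonProduct_twistOperatorAtThree_left`), so `π⟨f, M⟩ ⊆ ⟨g, M⟩` for `D`-stable `M`;
* **`planeIndex_dvd_three_mul_planeIndex`** — for a `D`-stable `M` and `B₃ g = f`: if the two lines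
  `Λ_h = ⟨h, M ∩ (ℤh + ℤζ₃h)⟩` coincide, `πΛ ⊆ Λ` and `[Λ : πΛ] ∣ 3`, then `planeIndex M f ∣ 3 · planeIndex M g`;
* the lattice `Λ = ℤc + ℤζ₃c`: `map_inf_eq_closure_of_le` (`Λ_h = ℤ⟨h,h⟩ + ℤζ₃⟨h,h⟩` when `h, ζ₃h ∈ M`),
  `map_mulLeft_closure_pair_le` (`πΛ ⊆ Λ`), `relIndex_map_mulLeft_closure_pair_dvd_three` (`[Λ : πΛ] ∣ 3`, via
  `ℤ/3 ↠ Λ/πΛ`).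

Elementary (Atkin–Lehner 1970 §4 normaliser bookkeeping, Diamond–Shurman §5.5 adjoints, index calculus); E-blind.
BSD is not proved by this; Manin's conjecture is not proved by this.
-/

set_option autoImplicit false
set_option linter.dupNamespace false

noncomputable section

open scoped MatrixGroups ModularForm ComplexConjugate
open CongruenceSubgroup
open Literature.NumberTheory.EllipticCurves Literature.NumberTheory.EllipticCurves.ModularForms
open Summit.BirchSwinnertonDyer.Rank1Residual.ManinAdditive
open Summit.BirchSwinnertonDyer.Rank1Residual.ManinAdditive.RamanujanCut
open Summit.BirchSwinnertonDyer.Rank1Residual.ManinAdditive.ConwayNortonThree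

namespace Summit.BirchSwinnertonDyer.BirchSwinnertonDyer.Theorems.ManinLocalTwoThree

/-! ### Index bookkeeping for additive subgroups of `ℂ` -/

/-- **Index transport.**  For additive subgroups `Λ ≤ A`, `Λ ≤ B` of `ℂ` and `π ≠ 0` with `π A ⊆ B` and `π Λ ⊆ Λ`:
`[A : Λ] ∣ [Λ : πΛ] · [B : Λ]` (indices `0` when infinite).  Both sides count `[B : πΛ]` along the two chains
`πΛ ≤ πA ≤ B` and `πΛ ≤ Λ ≤ B`, and `[πA : πΛ] = [A : Λ]`. -/
theorem relIndex_dvd_relIndex_mul_of_mul_le {π : ℂ} (hπ : π ≠ 0) {A B Λ : AddSubgroup ℂ}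
    (hΛA : Λ ≤ A) (hΛB : Λ ≤ B) (hAB : A.map (AddMonoidHom.mulLeft π) ≤ B)
    (hΛ : Λ.map (AddMonoidHom.mulLeft π) ≤ Λ) :
    Λ.relIndex A ∣ (Λ.map (AddMonoidHom.mulLeft π)).relIndex Λ * Λ.relIndex B := by
  have hm : Function.Injective (AddMonoidHom.mulLeft π) := mul_right_injective₀ hπ
  have h1 : (Λ.map (AddMonoidHom.mulLeft π)).relIndex (A.map (AddMonoidHom.mulLeft π)) = Λ.relIndex A :=
    AddSubgroup.relIndex_map_map_of_injective Λ A hm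
  have c1 := AddSubgroup.relIndex_mul_relIndex (Λ.map (AddMonoidHom.mulLeft π))
    (A.map (AddMonoidHom.mulLeft π)) B (AddSubgroup.map_mono hΛA) hAB
  have c2 := AddSubgroup.relIndex_mul_relIndex (Λ.map (AddMonoidHom.mulLeft π)) Λ B hΛ hΛB
  rw [h1] at c1
  exact ⟨(A.map (AddMonoidHom.mulLeft π)).relIndex B, c2.trans c1.symm⟩

/-- **Arithmetic of `a ∣ 3b ∧ b ∣ 3a`**: the prime-to-`3` parts agree and the `3`-adic valuations differ by at most one
(also in the degenerate case `a = 0 ↔ b = 0`). -/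
theorem div_pow_eq_and_natAbs_sub_le_one_of_dvd_three_mul {a b : ℕ} (hab : a ∣ 3 * b) (hba : b ∣ 3 * a) :
    a / 3 ^ padicValNat 3 a = b / 3 ^ padicValNat 3 b ∧
      ((padicValNat 3 a : ℤ) - padicValNat 3 b).natAbs ≤ 1 := by
  rcases Nat.eq_zero_or_pos a with rfl | ha
  · have hb : b = 0 := by simpa using hab
    subst hb; simp
  rcases Nat.eq_zero_or_pos b with rfl | hb
  · have : a = 0 := by simpa using hba
    omega
  haveI : Fact (Nat.Prime 3) := ⟨Nat.prime_three⟩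
  -- the `3`-adic valuations differ by at most one
  have hval : ∀ {x y : ℕ}, 0 < x → 0 < y → x ∣ 3 * y → padicValNat 3 x ≤ padicValNat 3 y + 1 := by
    intro x y hx hy hxy
    have h : 3 ^ padicValNat 3 x ∣ 3 * y := pow_padicValNat_dvd.trans hxy
    have h' := (padicValNat_dvd_iff_le (show 3 * y ≠ 0 by omega)).mp h
    rwa [padicValNat.mul (by norm_num) hy.ne', padicValNat_self, add_comm] at h'
  have hva := hval ha hb hab
  have hvb := hval hb ha hba
  refine ⟨?_, by omega⟩
  -- the prime-to-`3` parts divide each other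
  have hdvd : ∀ {x y : ℕ}, 0 < x → 0 < y → x ∣ 3 * y →
      x / 3 ^ padicValNat 3 x ∣ y / 3 ^ padicValNat 3 y := by
    intro x y hx hy hxy
    have hx' : 3 ^ padicValNat 3 x * (x / 3 ^ padicValNat 3 x) = x := Nat.mul_div_cancel' pow_padicValNat_dvd
    have hy' : 3 ^ padicValNat 3 y * (y / 3 ^ padicValNat 3 y) = y := Nat.mul_div_cancel' pow_padicValNat_dvd
    have hcop : Nat.Coprime (x / 3 ^ padicValNat 3 x) 3 := by
      rw [Nat.coprime_comm, Nat.Prime.coprime_iff_not_dvd Nat.prime_three]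
      intro h3
      have : 3 ^ (padicValNat 3 x + 1) ∣ x := by
        calc 3 ^ (padicValNat 3 x + 1) = 3 ^ padicValNat 3 x * 3 := pow_succ _ _
          _ ∣ 3 ^ padicValNat 3 x * (x / 3 ^ padicValNat 3 x) := Nat.mul_dvd_mul_left _ h3
          _ = x := hx'
      exact pow_succ_padicValNat_not_dvd hx.ne' this
    have h1 : x / 3 ^ padicValNat 3 x ∣ 3 ^ (padicValNat 3 y + 1) * (y / 3 ^ padicValNat 3 y) := by
      calc x / 3 ^ padicValNat 3 x ∣ x := Nat.div_dvd_of_dvd pow_padicValNat_dvd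
        _ ∣ 3 * y := hxy
        _ = 3 ^ (padicValNat 3 y + 1) * (y / 3 ^ padicValNat 3 y) := by
          rw [pow_succ', mul_assoc, hy']
    exact (Nat.Coprime.pow_right _ hcop).dvd_of_dvd_mul_left h1
  exact Nat.dvd_antisymm (hdvd ha hb hab) (hdvd hb ha hba)

/-! ### The plane index as a relative index inside `ℂ` -/

variable {N : ℕ} [NeZero N]

/-- For a `ℤ`-submodule `Q` of `M`, `Nat.card (M ⧸ Q)` is the index of `Q` as an additive subgroup. -/
theorem natCard_quotient_eq_index {V : Type*} [AddCommGroup V] {M : Submodule ℤ V} (Q : Submodule ℤ M) :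
    Nat.card (M ⧸ Q) = Q.toAddSubgroup.index := by
  rw [AddSubgroup.index_eq_card]
  rfl

/-- **The plane index through the Petersson functional.**  With `L_h = ⟨h, ·⟩` and `P_h = ℤ h + ℤ ζ₃ h`:
`planeIndex M h = [L_h(M) : L_h(M ∩ P_h)]` as additive subgroups of `ℂ` (first isomorphism theorem: the relative
kernel `P_h + M ∩ h^⊥` inside `M` is the preimage of `L_h(M ∩ P_h)` under `L_h|_M`; `0` for an infinite index on both
sides). -/
theorem planeIndex_eq_relIndex (M : Submodule ℤ (CuspForm (Gamma0 N) 2)) (h : CuspForm (Gamma0 N) 2) :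
    planeIndex M h =
      ((M ⊓ ((ℤ ∙ h) ⊔ (ℤ ∙ (zeta3 • h)))).toAddSubgroup.map
          (peterssonProductₗ (Gamma0 N) 2 h).toAddMonoidHom).relIndex
        (M.toAddSubgroup.map (peterssonProductₗ (Gamma0 N) 2 h).toAddMonoidHom) := by
  set L := (peterssonProductₗ (Gamma0 N) 2 h).toAddMonoidHom with hL
  set P : Submodule ℤ (CuspForm (Gamma0 N) 2) := (ℤ ∙ h) ⊔ (ℤ ∙ (zeta3 • h)) with hP
  let φ : M →+ ℂ := L.comp M.subtype.toAddMonoidHom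
  have hφ : ∀ x : M, φ x = peterssonProduct (Gamma0 N) 2 h x := fun x => rfl
  have hLx : ∀ x : CuspForm (Gamma0 N) 2, L x = peterssonProduct (Gamma0 N) 2 h x := fun x => rfl
  have hrange : φ.range = M.toAddSubgroup.map L := by
    ext z
    constructor
    · rintro ⟨x, rfl⟩
      exact ⟨x, x.2, rfl⟩
    · rintro ⟨x, hx, rfl⟩
      exact ⟨⟨x, hx⟩, rfl⟩
  have hQ : ((P ⊔ (M ⊓ (LinearMap.ker (peterssonProductₗ (Gamma0 N) 2 h)).restrictScalars ℤ)).comap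
      M.subtype).toAddSubgroup = ((M ⊓ P).toAddSubgroup.map L).comap φ := by
    ext x
    simp only [Submodule.mem_toAddSubgroup, Submodule.mem_comap, AddSubgroup.mem_comap, AddSubgroup.mem_map,
      Submodule.coe_subtype]
    constructor
    · intro hx
      obtain ⟨y, hy, z, hz, hyz⟩ := Submodule.mem_sup.mp hx
      obtain ⟨hzM, hzk⟩ := Submodule.mem_inf.mp hz
      have hyM : y ∈ M := by
        have : y = (x : CuspForm (Gamma0 N) 2) - z := by rw [← hyz, add_sub_cancel_right]
        rw [this]
        exact M.sub_mem x.2 hzM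
      refine ⟨y, Submodule.mem_inf.mpr ⟨hyM, hy⟩, ?_⟩
      rw [Submodule.restrictScalars_mem, LinearMap.mem_ker, peterssonProductₗ_apply] at hzk
      rw [hφ, hLx, ← hyz, peterssonProduct_add_right, hzk, add_zero]
    · rintro ⟨w, hw, hwx⟩
      obtain ⟨hwM, hwP⟩ := Submodule.mem_inf.mp hw
      rw [hφ, hLx] at hwx
      refine Submodule.mem_sup.mpr ⟨w, hwP, (x : CuspForm (Gamma0 N) 2) - w,
        Submodule.mem_inf.mpr ⟨M.sub_mem x.2 hwM, ?_⟩, add_sub_cancel w _⟩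
      rw [Submodule.restrictScalars_mem, LinearMap.mem_ker, peterssonProductₗ_apply, peterssonProduct_sub_right',
        hwx, sub_self]
  unfold planeIndex
  rw [natCard_quotient_eq_index, hQ, AddSubgroup.index_comap, hrange]

/-! ### `ζ₃` bookkeeping -/

/-- `1 + ζ₃ + ζ₃² = 0`. -/
theorem one_add_zeta3_add_sq : 1 + zeta3 + zeta3 ^ 2 = 0 := by
  have h := isPrimitiveRoot_zeta3.geom_sum_eq_zero (by norm_num : 1 < 3)
  simpa [Finset.sum_range_succ, add_assoc] using h

/-- `ζ₃² = -1 - ζ₃`. -/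
theorem zeta3_sq : zeta3 ^ 2 = -1 - zeta3 := by
  linear_combination one_add_zeta3_add_sq

/-- `(ζ₃ − ζ₃²)² = −3` (`ζ₃ − ζ₃² = √−3`). -/
theorem zeta3_sub_sq_pow_two : (zeta3 - zeta3 ^ 2) ^ 2 = -3 := by
  linear_combination (zeta3 ^ 2 - 3 * zeta3 + 3) * one_add_zeta3_add_sq

/-- `ζ₃ − ζ₃² ≠ 0`. -/
theorem zeta3_sub_sq_ne_zero : zeta3 - zeta3 ^ 2 ≠ 0 := by
  intro h
  have := zeta3_sub_sq_pow_two
  rw [h] at this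
  norm_num at this

/-- `ζ₃ − ζ₃² = 1 + 2ζ₃`. -/
theorem zeta3_sub_sq_eq : zeta3 - zeta3 ^ 2 = 1 + 2 * zeta3 := by
  linear_combination (-1 : ℂ) * one_add_zeta3_add_sq

/-! ### The operator `D = t_{1/3} − t_{2/3} = (ζ₃ − ζ₃²) B₃` and the Conway–Norton lattice -/

/-- `t_{2/3} = t_{1/3} ∘ t_{1/3}` on `S₂(Γ₀(N))`, `9 ∣ N` (`q`-expansions: `ζ₃^{2n} = (ζ₃ⁿ)²`). -/
theorem thirdTranslate_two_eq_comp (h9 : 9 ∣ N) :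
    thirdTranslate N 2 2 = thirdTranslate N 2 1 ∘ₗ thirdTranslate N 2 1 := by
  refine LinearMap.ext fun f => eq_of_forall_cuspCoeff_eq_gamma0 fun n => ?_
  rw [LinearMap.comp_apply, cuspCoeff_thirdTranslate_two h9, cuspCoeff_thirdTranslate_two h9,
    cuspCoeff_thirdTranslate_two h9]
  ring

/-- `(ζ₃ − ζ₃²) • B₃ x = t_{1/3} x − t_{2/3} x` (definition of `B₃`). -/
theorem smul_twistOperatorAtThree_eq_sub (k : ℤ) (x : CuspForm (Gamma0 N) k) :
    (zeta3 - zeta3 ^ 2) • twistOperatorAtThree N k x = thirdTranslate N k 1 x - thirdTranslate N k 2 x := by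
  simp only [twistOperatorAtThree, LinearMap.smul_apply, LinearMap.sub_apply, smul_smul,
    mul_inv_cancel₀ zeta3_sub_sq_ne_zero, one_smul]

/-- `M^G(N) ≤ S₂(Γ₀(N);ℤ) ⊗ ℤ[ζ₃]`. -/
theorem conwayNortonLatticeAtThree_le : conwayNortonLatticeAtThree N ≤ eisensteinSpan (integralCuspForms0 N 2) :=
  sSup_le fun _ hM => hM.1

/-- `M^G(N)` is `ζ₃`-stable. -/
theorem zeta3_smul_mem_conwayNortonLatticeAtThree {x : CuspForm (Gamma0 N) 2}
    (hx : x ∈ conwayNortonLatticeAtThree N) : zeta3 • x ∈ conwayNortonLatticeAtThree N := by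
  have h : (conwayNortonLatticeAtThree N).map
      ((zeta3 • LinearMap.id : CuspForm (Gamma0 N) 2 →ₗ[ℂ] CuspForm (Gamma0 N) 2).restrictScalars ℤ) ≤
      conwayNortonLatticeAtThree N := by
    unfold conwayNortonLatticeAtThree
    rw [Submodule.map_le_iff_le_comap]
    exact sSup_le fun M hM => Submodule.map_le_iff_le_comap.mp (hM.2.1.trans (le_sSup hM))
  exact h ⟨x, hx, rfl⟩

/-- `M^G(N)` is `w_{Q_p}`-stable for every prime `p ∣ N`. -/
theorem atkinLehnerInvolutionAt_mem_conwayNortonLatticeAtThree {p : ℕ} (hp : p.Prime) (hpN : p ∣ N)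
    {x : CuspForm (Gamma0 N) 2} (hx : x ∈ conwayNortonLatticeAtThree N) :
    atkinLehnerInvolutionAt N 2 p x ∈ conwayNortonLatticeAtThree N := by
  have h : (conwayNortonLatticeAtThree N).map ((atkinLehnerInvolutionAt N 2 p).restrictScalars ℤ) ≤
      conwayNortonLatticeAtThree N := by
    unfold conwayNortonLatticeAtThree
    rw [Submodule.map_le_iff_le_comap]
    exact sSup_le fun M hM => Submodule.map_le_iff_le_comap.mp ((hM.2.2.1 p hp hpN).trans (le_sSup hM))
  exact h ⟨x, hx, rfl⟩

/-- `M^G(N)` is `t_{1/3}`-stable. -/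
theorem thirdTranslate_one_mem_conwayNortonLatticeAtThree {x : CuspForm (Gamma0 N) 2}
    (hx : x ∈ conwayNortonLatticeAtThree N) : thirdTranslate N 2 1 x ∈ conwayNortonLatticeAtThree N := by
  have h : (conwayNortonLatticeAtThree N).map ((thirdTranslate N 2 1).restrictScalars ℤ) ≤
      conwayNortonLatticeAtThree N := by
    unfold conwayNortonLatticeAtThree
    rw [Submodule.map_le_iff_le_comap]
    exact sSup_le fun M hM => Submodule.map_le_iff_le_comap.mp (hM.2.2.2.trans (le_sSup hM))
  exact h ⟨x, hx, rfl⟩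

/-- Any `ℤ`-lattice with the four closure properties lies in `M^G(N)` (it is the largest such). -/
theorem le_conwayNortonLatticeAtThree {M : Submodule ℤ (CuspForm (Gamma0 N) 2)}
    (h1 : M ≤ eisensteinSpan (integralCuspForms0 N 2))
    (h2 : M.map ((zeta3 • LinearMap.id : CuspForm (Gamma0 N) 2 →ₗ[ℂ] CuspForm (Gamma0 N) 2).restrictScalars ℤ) ≤ M)
    (h3 : ∀ p : ℕ, p.Prime → p ∣ N → M.map ((atkinLehnerInvolutionAt N 2 p).restrictScalars ℤ) ≤ M)
    (h4 : M.map ((thirdTranslate N 2 1).restrictScalars ℤ) ≤ M) : M ≤ conwayNortonLatticeAtThree N :=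
  le_sSup ⟨h1, h2, h3, h4⟩

/-- **`D = (ζ₃ − ζ₃²) B₃` preserves `M^G(N)`** (`9 ∣ N`): `D = t_{1/3} − t_{1/3}²`. -/
theorem smul_twistOperatorAtThree_mem_conwayNortonLatticeAtThree (h9 : 9 ∣ N) {x : CuspForm (Gamma0 N) 2}
    (hx : x ∈ conwayNortonLatticeAtThree N) :
    (zeta3 - zeta3 ^ 2) • twistOperatorAtThree N 2 x ∈ conwayNortonLatticeAtThree N := by
  rw [smul_twistOperatorAtThree_eq_sub, thirdTranslate_two_eq_comp h9, LinearMap.comp_apply]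
  exact Submodule.sub_mem _ (thirdTranslate_one_mem_conwayNortonLatticeAtThree hx)
    (thirdTranslate_one_mem_conwayNortonLatticeAtThree (thirdTranslate_one_mem_conwayNortonLatticeAtThree hx))

/-- **Petersson transport**: `⟨g, D x⟩ = (ζ₃ − ζ₃²) ⟨f, x⟩` whenever `B₃ g = f` (`B₃` is self-adjoint). -/
theorem peterssonProduct_smul_twistOperatorAtThree_of_swap {f g : CuspForm (Gamma0 N) 2}
    (hg : twistOperatorAtThree N 2 g = f) (x : CuspForm (Gamma0 N) 2) :
    peterssonProduct (Gamma0 N) 2 g ((zeta3 - zeta3 ^ 2) • twistOperatorAtThree N 2 x) =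
      (zeta3 - zeta3 ^ 2) * peterssonProduct (Gamma0 N) 2 f x := by
  rw [peterssonProduct_smul_right, ← peterssonProduct_twistOperatorAtThree_left, hg]

/-- `L_g(D M) ⊇ π L_f(M)`: the image `⟨f, M⟩ ⊂ ℂ` multiplied by `π = ζ₃ − ζ₃²` lies in `⟨g, M⟩` for a `D`-stable `M`
and `B₃ g = f`. -/
theorem map_mulLeft_map_peterssonProduct_le {M : Submodule ℤ (CuspForm (Gamma0 N) 2)}
    (hD : ∀ x ∈ M, (zeta3 - zeta3 ^ 2) • twistOperatorAtThree N 2 x ∈ M) {f g : CuspForm (Gamma0 N) 2}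
    (hg : twistOperatorAtThree N 2 g = f) :
    (M.toAddSubgroup.map (peterssonProductₗ (Gamma0 N) 2 f).toAddMonoidHom).map
        (AddMonoidHom.mulLeft (zeta3 - zeta3 ^ 2)) ≤
      M.toAddSubgroup.map (peterssonProductₗ (Gamma0 N) 2 g).toAddMonoidHom := by
  rintro z ⟨y, ⟨x, hx, rfl⟩, rfl⟩
  refine ⟨(zeta3 - zeta3 ^ 2) • twistOperatorAtThree N 2 x, hD x hx, ?_⟩
  change peterssonProduct (Gamma0 N) 2 g _ = (zeta3 - zeta3 ^ 2) * peterssonProduct (Gamma0 N) 2 f x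
  exact peterssonProduct_smul_twistOperatorAtThree_of_swap hg x

/-! ### The transport theorem: `planeIndex M f ∣ 3 · planeIndex M g` -/

/-- **Plane-index transport.**  Let `M` be a `D`-stable `ℤ`-lattice (`D = (ζ₃ − ζ₃²) B₃`) and `B₃ g = f`.  Write
`L_h = ⟨h, ·⟩`, `P_h = ℤ h + ℤ ζ₃ h`, `Λ_h = L_h(M ∩ P_h) ⊂ ℂ`.  If `Λ_f = Λ_g =: Λ`, `π Λ ⊆ Λ` and `[Λ : πΛ] ∣ 3`
(`π = ζ₃ − ζ₃²`), then `planeIndex M f ∣ 3 · planeIndex M g`: indeed `π L_f(M) = L_g(D M) ⊆ L_g(M)` by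
self-adjointness of `B₃`, and the index chains of `relIndex_dvd_relIndex_mul_of_mul_le` apply. -/
theorem planeIndex_dvd_three_mul_planeIndex {M : Submodule ℤ (CuspForm (Gamma0 N) 2)}
    (hD : ∀ x ∈ M, (zeta3 - zeta3 ^ 2) • twistOperatorAtThree N 2 x ∈ M) {f g : CuspForm (Gamma0 N) 2}
    (hg : twistOperatorAtThree N 2 g = f)
    (hΛ : (M ⊓ ((ℤ ∙ f) ⊔ (ℤ ∙ (zeta3 • f)))).toAddSubgroup.map (peterssonProductₗ (Gamma0 N) 2 f).toAddMonoidHom =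
      (M ⊓ ((ℤ ∙ g) ⊔ (ℤ ∙ (zeta3 • g)))).toAddSubgroup.map (peterssonProductₗ (Gamma0 N) 2 g).toAddMonoidHom)
    (hΛπ : ((M ⊓ ((ℤ ∙ f) ⊔ (ℤ ∙ (zeta3 • f)))).toAddSubgroup.map
        (peterssonProductₗ (Gamma0 N) 2 f).toAddMonoidHom).map (AddMonoidHom.mulLeft (zeta3 - zeta3 ^ 2)) ≤
      (M ⊓ ((ℤ ∙ f) ⊔ (ℤ ∙ (zeta3 • f)))).toAddSubgroup.map (peterssonProductₗ (Gamma0 N) 2 f).toAddMonoidHom)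
    (h3 : (((M ⊓ ((ℤ ∙ f) ⊔ (ℤ ∙ (zeta3 • f)))).toAddSubgroup.map
        (peterssonProductₗ (Gamma0 N) 2 f).toAddMonoidHom).map (AddMonoidHom.mulLeft (zeta3 - zeta3 ^ 2))).relIndex
        ((M ⊓ ((ℤ ∙ f) ⊔ (ℤ ∙ (zeta3 • f)))).toAddSubgroup.map (peterssonProductₗ (Gamma0 N) 2 f).toAddMonoidHom)
        ∣ 3) :
    planeIndex M f ∣ 3 * planeIndex M g := by
  rw [planeIndex_eq_relIndex, planeIndex_eq_relIndex]
  have hΛA : (M ⊓ ((ℤ ∙ f) ⊔ (ℤ ∙ (zeta3 • f)))).toAddSubgroup.map (peterssonProductₗ (Gamma0 N) 2 f).toAddMonoidHom ≤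
      M.toAddSubgroup.map (peterssonProductₗ (Gamma0 N) 2 f).toAddMonoidHom :=
    AddSubgroup.map_mono fun x hx => (Submodule.mem_inf.mp hx).1
  have hΛB : (M ⊓ ((ℤ ∙ f) ⊔ (ℤ ∙ (zeta3 • f)))).toAddSubgroup.map (peterssonProductₗ (Gamma0 N) 2 f).toAddMonoidHom ≤
      M.toAddSubgroup.map (peterssonProductₗ (Gamma0 N) 2 g).toAddMonoidHom := by
    rw [hΛ]
    exact AddSubgroup.map_mono fun x hx => (Submodule.mem_inf.mp hx).1
  have h := relIndex_dvd_relIndex_mul_of_mul_le zeta3_sub_sq_ne_zero hΛA hΛB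
    (map_mulLeft_map_peterssonProduct_le hD hg) hΛπ
  rw [hΛ] at h ⊢
  rw [hΛ] at h3
  exact h.trans (mul_dvd_mul_right h3 _)

omit [NeZero N] in
/-- `ℤ h + ℤ ζ₃ h` as an additive subgroup is generated by `h, ζ₃ h`. -/
theorem toAddSubgroup_span_pair (h : CuspForm (Gamma0 N) 2) :
    ((ℤ ∙ h) ⊔ (ℤ ∙ (zeta3 • h))).toAddSubgroup = AddSubgroup.closure {h, zeta3 • h} := by
  rw [← Submodule.span_int_eq_addSubgroupClosure, Submodule.span_insert]

/-- **Case `P_h ≤ M`**: `Λ_h = ℤ c + ℤ ζ₃ c` with `c = ⟨h, h⟩`. -/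
theorem map_inf_eq_closure_of_le {M : Submodule ℤ (CuspForm (Gamma0 N) 2)} {h : CuspForm (Gamma0 N) 2}
    (hM : (ℤ ∙ h) ⊔ (ℤ ∙ (zeta3 • h)) ≤ M) :
    (M ⊓ ((ℤ ∙ h) ⊔ (ℤ ∙ (zeta3 • h)))).toAddSubgroup.map (peterssonProductₗ (Gamma0 N) 2 h).toAddMonoidHom =
      AddSubgroup.closure {peterssonProduct (Gamma0 N) 2 h h, zeta3 * peterssonProduct (Gamma0 N) 2 h h} := by
  rw [inf_eq_right.mpr hM, toAddSubgroup_span_pair, AddMonoidHom.map_closure, Set.image_pair]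
  change AddSubgroup.closure {peterssonProduct (Gamma0 N) 2 h h, peterssonProduct (Gamma0 N) 2 h (zeta3 • h)} = _
  rw [peterssonProduct_smul_right]

/-- `π (ℤ c + ℤ ζ₃ c) ⊆ ℤ c + ℤ ζ₃ c` for `π = ζ₃ − ζ₃² = 1 + 2ζ₃ ∈ ℤ[ζ₃]`. -/
theorem map_mulLeft_closure_pair_le (c : ℂ) :
    (AddSubgroup.closure {c, zeta3 * c}).map (AddMonoidHom.mulLeft (zeta3 - zeta3 ^ 2)) ≤
      AddSubgroup.closure {c, zeta3 * c} := by
  rw [AddMonoidHom.map_closure, Set.image_pair, AddSubgroup.closure_le]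
  intro z hz
  simp only [AddMonoidHom.coe_mulLeft, Set.mem_insert_iff, Set.mem_singleton_iff] at hz
  rw [SetLike.mem_coe, AddSubgroup.mem_closure_pair]
  have h3 : zeta3 ^ 3 = 1 := isPrimitiveRoot_zeta3.pow_eq_one
  rcases hz with rfl | rfl
  · refine ⟨1, 2, ?_⟩
    simp only [zsmul_eq_mul]
    push_cast
    linear_combination c * one_add_zeta3_add_sq
  · refine ⟨-2, -1, ?_⟩
    simp only [zsmul_eq_mul]
    push_cast
    linear_combination (-c) * one_add_zeta3_add_sq + c * h3

/-- `[ℤ c + ℤ ζ₃ c : π(ℤ c + ℤ ζ₃ c)] ∣ 3`: modulo `π Λ` every element of `Λ = ℤ c + ℤ ζ₃ c` is a multiple of `c`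
(`ζ₃ c ≡ −2c`) and `3c = −π² c ∈ πΛ`, so `ℤ/3 ↠ Λ/πΛ`. -/
theorem relIndex_map_mulLeft_closure_pair_dvd_three (c : ℂ) :
    ((AddSubgroup.closure {c, zeta3 * c}).map (AddMonoidHom.mulLeft (zeta3 - zeta3 ^ 2))).relIndex
      (AddSubgroup.closure {c, zeta3 * c}) ∣ 3 := by
  set Λ := AddSubgroup.closure ({c, zeta3 * c} : Set ℂ) with hΛdef
  set Λπ := Λ.map (AddMonoidHom.mulLeft (zeta3 - zeta3 ^ 2)) with hΛπdef
  have h3 : zeta3 ^ 3 = 1 := isPrimitiveRoot_zeta3.pow_eq_one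
  have hc : c ∈ Λ := AddSubgroup.subset_closure (by simp)
  have hζc : zeta3 * c ∈ Λ := AddSubgroup.subset_closure (by simp)
  -- `3c ∈ πΛ` and `ζ₃ c + 2c ∈ πΛ`
  have h3c : (3 : ℂ) * c ∈ Λπ := by
    refine ⟨-(c + 2 • (zeta3 * c)), Λ.neg_mem (Λ.add_mem hc (Λ.nsmul_mem hζc 2)), ?_⟩
    simp only [AddMonoidHom.coe_mulLeft, nsmul_eq_mul]
    push_cast
    linear_combination (-c) * one_add_zeta3_add_sq + (2 * c) * h3
  have hζ2c : zeta3 * c + 2 * c ∈ Λπ := by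
    refine ⟨-(zeta3 * c), Λ.neg_mem hζc, ?_⟩
    simp only [AddMonoidHom.coe_mulLeft]
    linear_combination (-c) * one_add_zeta3_add_sq + c * h3
  -- the surjection `ℤ/3 ↠ Λ ⧸ πΛ`, `k ↦ k • c`
  let cΛ : Λ := ⟨c, hc⟩
  let ψ : ℤ →+ Λ ⧸ Λπ.addSubgroupOf Λ := (QuotientAddGroup.mk' _).comp (zmultiplesHom Λ cΛ)
  have hψ : ∀ k : ℤ, ψ k = QuotientAddGroup.mk (k • cΛ) := fun k => rfl
  have hψ3 : ψ 3 = 0 := by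
    rw [hψ, QuotientAddGroup.eq_zero_iff, AddSubgroup.mem_addSubgroupOf]
    simpa [cΛ, zsmul_eq_mul] using h3c
  let ψ' : ZMod 3 →+ Λ ⧸ Λπ.addSubgroupOf Λ := ZMod.lift 3 ⟨ψ, hψ3⟩
  have hsurj : Function.Surjective ψ' := by
    rintro ⟨x⟩
    obtain ⟨m, n, hx⟩ := AddSubgroup.mem_closure_pair.mp x.2
    refine ⟨((m + n : ℤ) : ZMod 3), ?_⟩
    change ψ' _ = QuotientAddGroup.mk x
    rw [ZMod.lift_coe, hψ, QuotientAddGroup.eq, AddSubgroup.mem_addSubgroupOf]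
    change -(((m + n : ℤ) • cΛ : Λ) : ℂ) + (x : ℂ) ∈ Λπ
    have : -(((m + n : ℤ) • cΛ : Λ) : ℂ) + (x : ℂ) = n • (zeta3 * c + 2 * c) + (-n) • ((3 : ℂ) * c) := by
      simp only [AddSubgroupClass.coe_zsmul, cΛ, ← hx, zsmul_eq_mul]
      push_cast
      ring
    rw [this]
    exact Λπ.add_mem (Λπ.zsmul_mem hζ2c n) (Λπ.zsmul_mem h3c (-n))
  have hcard := AddSubgroup.card_dvd_of_surjective ψ' hsurj
  rw [Nat.card_zmod] at hcard
  rw [AddSubgroup.relIndex, AddSubgroup.index_eq_card]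
  exact hcard

end Summit.BirchSwinnertonDyer.BirchSwinnertonDyer.Theorems.ManinLocalTwoThree

end
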